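import Summits.ValiantsHypothesis.ValiantsHypothesis.Theorems.GrenetZeonDualUnipotentThreeHalvesHeavyTopIotaFourTypeFour
import Summits.ValiantsHypothesis.ValiantsHypothesis.Theorems.GrenetZeonDualUnipotentThreeHalvesHeavyTopIotaFourTypeThreeOne
import Summits.ValiantsHypothesis.ValiantsHypothesis.Theorems.GrenetZeonDualUnipotentThreeHalvesHeavyTopIotaFourConstraints
import Summits.ValiantsHypothesis.ValiantsHypothesis.Theorems.GrenetZeonDualUnipotentThreeHalvesHeavyTopIrreducibleData
import Literature.LinearAlgebra.Matrix.AdjugateOfNilpotent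

/-!
# `GrenetZeon.DualUnipotentThreeHalves` (stmt-ValiantsHypothesis-24318), R2 `HeavyTopLaw` — ι(4) = 3 ASSEMBLY modulo the two
# Jordan normal forms (cell «val-heavytop-census», engine seat val-htc-eng-1; pen split of val-htc-lead 18:12Z)

`reducible_of_four_le_finrank_of_jordan`: every linear space `V ≤ M₄(ℂ)` of nilpotent matrices with `dim V ≥ 4` has a common
invariant subspace `0 ≠ U ≠ ℂ⁴` — ASSUMING the two elementary Jordan normal forms as hypotheses (`hJ4`: a matrix with
`A⁴ = 0 ≠ A³` is conjugate to `J₄ = E₀₁+E₁₂+E₂₃`; `hJ31`: a matrix with `A³ = 0 ≠ A²` is conjugate to `E₀₁+E₁₂`), which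
val-port-3 g2 types as a separate helper; the unconditional theorem is then one line.  Ingredients (all ✓ in the tree):
`pow_card_eq_zero_of_isNilpotent` (Literature, `A⁴ = 0`), ✓ `reducible_of_sq_zero` (p646307; nilindex ≤ 2), port-3's ✓
`constraints_of_J4` / `constraints_of_E12_E23` / `entry33_eq_zero_of_E12_E23` (the linear «tangent cut» (T1)), and this seat's
✓ `typeFour_row_or_col` (p655522) / ✓ `typeThreeOne_col` (p655765) (graded limit + case analysis).  Transport: `V' = P V Q`
(`PQ = QP = 1`) is the image of `V` under a linear equivalence (same `finrank`, powers conjugate), and a zero first column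
(resp. zero last row) of every member of `V'` pulls back to the common kernel vector `Q e₀` (resp. the invariant hyperplane
`{y : (P y)₃ = 0}`) of `V`.

Honest framing: calibration datum ι(4) = 3 for INSTANCES §7 (GRID (4,6) is decided by Q4, not by this); nothing here proves or
refutes `HeavyTopLaw`, 24318, S3b or 8062; `VP ≠ VNP` is not moved.  No definitions, no named facts (the Jordan forms are
hypotheses of the theorem, discharged by the companion helper). [NOTE-iota4 (this seat); lead REPLICATION-iota4]
-/

noncomputable section

-- single-conjunct layout: Sub = Summit, duplicated namespace component intended
set_option linter.dupNamespace false

namespace Summit.ValiantsHypothesis.ValiantsHypothesis.Theorems.GrenetZeon.HeavyTopIotaFour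

open Matrix

/-- Conjugation `X ↦ P X Q` by an invertible pair (`PQ = QP = 1`) as a linear equivalence of `M₄(ℂ)`. -/
theorem conjEquiv_exists (P Q : Matrix (Fin 4) (Fin 4) ℂ) (hPQ : P * Q = 1) (hQP : Q * P = 1) :
    ∃ e : Matrix (Fin 4) (Fin 4) ℂ ≃ₗ[ℂ] Matrix (Fin 4) (Fin 4) ℂ, ∀ X, e X = P * X * Q := by
  refine ⟨{ toFun := fun X => P * X * Q, invFun := fun Y => Q * Y * P,
            map_add' := fun X Y => by rw [Matrix.mul_add, Matrix.add_mul],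
            map_smul' := fun c X => by simp,
            left_inv := fun X => ?_, right_inv := fun Y => ?_ }, fun X => rfl⟩
  · show Q * (P * X * Q) * P = X
    calc Q * (P * X * Q) * P = (Q * P) * X * (Q * P) := by simp only [Matrix.mul_assoc]
      _ = X := by rw [hQP, Matrix.one_mul, Matrix.mul_one]
  · show P * (Q * Y * P) * Q = Y
    calc P * (Q * Y * P) * Q = (P * Q) * Y * (P * Q) := by simp only [Matrix.mul_assoc]
      _ = Y := by rw [hPQ, Matrix.one_mul, Matrix.mul_one]

/-- Powers of a conjugate: `(P X Q)^k = P X^k Q` for `k ≥ 1`. -/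
theorem conj_pow_eq (P Q X : Matrix (Fin 4) (Fin 4) ℂ) (hQP : Q * P = 1) (k : ℕ) (hk : 1 ≤ k) :
    (P * X * Q) ^ k = P * X ^ k * Q := by
  rcases conj_pow P Q X hQP k with h | h
  · exact h
  · omega

/-- **ι(4) = 3, assembled modulo the Jordan normal forms** (see module docstring). -/
theorem reducible_of_four_le_finrank_of_jordan
    (hJ4 : ∀ A : Matrix (Fin 4) (Fin 4) ℂ, A ^ 4 = 0 → A ^ 3 ≠ 0 →
      ∃ P Q : Matrix (Fin 4) (Fin 4) ℂ, P * Q = 1 ∧ Q * P = 1 ∧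
        P * A * Q = !![0, 1, 0, 0; 0, 0, 1, 0; 0, 0, 0, 1; 0, 0, 0, 0])
    (hJ31 : ∀ A : Matrix (Fin 4) (Fin 4) ℂ, A ^ 3 = 0 → A ^ 2 ≠ 0 →
      ∃ P Q : Matrix (Fin 4) (Fin 4) ℂ, P * Q = 1 ∧ Q * P = 1 ∧
        P * A * Q = !![0, 1, 0, 0; 0, 0, 1, 0; 0, 0, 0, 0; 0, 0, 0, 0])
    (V : Submodule ℂ (Matrix (Fin 4) (Fin 4) ℂ)) (hV : ∀ A ∈ V, IsNilpotent A) (hdim : 4 ≤ Module.finrank ℂ V) :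
    ∃ U : Submodule ℂ (Fin 4 → ℂ), U ≠ ⊥ ∧ U ≠ ⊤ ∧ ∀ A ∈ V, ∀ u ∈ U, A *ᵥ u ∈ U := by
  classical
  have hV4 : ∀ A ∈ V, A ^ 4 = 0 := fun A hA => by
    simpa using Literature.LinearAlgebra.Matrix.AdjugateOfNilpotent.pow_card_eq_zero_of_isNilpotent (hV A hA)
  -- transport package: from (P,Q) and an entrywise conclusion on V' = P V Q to an invariant subspace of V
  have transport_col : ∀ P Q : Matrix (Fin 4) (Fin 4) ℂ, P * Q = 1 → Q * P = 1 →
      (∀ B ∈ V, ∀ i : Fin 4, (P * B * Q) i 0 = 0) →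
      ∃ U : Submodule ℂ (Fin 4 → ℂ), U ≠ ⊥ ∧ U ≠ ⊤ ∧ ∀ A ∈ V, ∀ u ∈ U, A *ᵥ u ∈ U := by
    intro P Q hPQ hQP hcol
    -- common kernel vector u₀ = Q e₀
    set u₀ : Fin 4 → ℂ := Q *ᵥ (Pi.single 0 1) with hu₀
    have hu₀ne : u₀ ≠ 0 := by
      intro h
      have : P *ᵥ u₀ = (Pi.single 0 1 : Fin 4 → ℂ) := by
        rw [hu₀, Matrix.mulVec_mulVec, hPQ, Matrix.one_mulVec]
      rw [h, Matrix.mulVec_zero] at this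
      have := congr_fun this 0
      simp at this
    have hker : ∀ A ∈ V, A *ᵥ u₀ = 0 := by
      intro A hA
      have h1 : (P * A * Q) *ᵥ (Pi.single 0 1 : Fin 4 → ℂ) = 0 := by
        ext i; simp [Matrix.mulVec, hcol A hA i]
      have h2 : Q *ᵥ ((P * A * Q) *ᵥ (Pi.single 0 1 : Fin 4 → ℂ)) = A *ᵥ u₀ := by
        rw [hu₀, Matrix.mulVec_mulVec, Matrix.mulVec_mulVec]
        congr 1
        calc Q * (P * A * Q) = (Q * P) * A * Q := by simp only [Matrix.mul_assoc]
          _ = A * Q := by rw [hQP, Matrix.one_mul]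
      rw [← h2, h1, Matrix.mulVec_zero]
    refine ⟨ℂ ∙ u₀, ?_, ?_, ?_⟩
    · intro h
      exact hu₀ne ((Submodule.span_singleton_eq_bot).mp h)
    · intro h
      have hle : Module.finrank ℂ (ℂ ∙ u₀) = 1 := finrank_span_singleton hu₀ne
      rw [h, finrank_top, Module.finrank_fin_fun] at hle
      omega
    · intro A hA u hu
      obtain ⟨c, rfl⟩ := Submodule.mem_span_singleton.mp hu
      rw [Matrix.mulVec_smul, hker A hA, smul_zero]
      exact Submodule.zero_mem _
  have transport_row : ∀ P Q : Matrix (Fin 4) (Fin 4) ℂ, P * Q = 1 → Q * P = 1 →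
      (∀ B ∈ V, ∀ j : Fin 4, (P * B * Q) 3 j = 0) →
      ∃ U : Submodule ℂ (Fin 4 → ℂ), U ≠ ⊥ ∧ U ≠ ⊤ ∧ ∀ A ∈ V, ∀ u ∈ U, A *ᵥ u ∈ U := by
    intro P Q hPQ hQP hrow
    -- invariant hyperplane {y : (P y) 3 = 0}
    let φ : (Fin 4 → ℂ) →ₗ[ℂ] ℂ := (LinearMap.proj 3).comp (Matrix.mulVecLin P)
    have hφ : ∀ y, φ y = (P *ᵥ y) 3 := fun y => rfl
    refine ⟨LinearMap.ker φ, ?_, ?_, ?_⟩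
    · -- dim ker ≥ 3
      intro h
      have hrk := LinearMap.finrank_range_add_finrank_ker φ
      rw [h, finrank_bot, Module.finrank_fin_fun] at hrk
      have : Module.finrank ℂ (LinearMap.range φ) ≤ 1 := by
        calc Module.finrank ℂ (LinearMap.range φ) ≤ Module.finrank ℂ ℂ := Submodule.finrank_le _
          _ = 1 := Module.finrank_self ℂ
      omega
    · -- φ ≠ 0: φ (Q e₃) = 1
      intro h
      have hmem : Q *ᵥ (Pi.single 3 1 : Fin 4 → ℂ) ∈ LinearMap.ker φ := by rw [h]; exact Submodule.mem_top
      rw [LinearMap.mem_ker, hφ, Matrix.mulVec_mulVec, hPQ, Matrix.one_mulVec] at hmem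
      simp at hmem
    · intro A hA y hy
      rw [LinearMap.mem_ker, hφ] at hy ⊢
      have h1 : P *ᵥ (A *ᵥ y) = (P * A * Q) *ᵥ (P *ᵥ y) := by
        rw [Matrix.mulVec_mulVec, Matrix.mulVec_mulVec]
        congr 1
        calc P * A = P * A * (Q * P) := by rw [hQP, Matrix.mul_one]
          _ = P * A * Q * P := by simp only [Matrix.mul_assoc]
      rw [h1]
      simp [Matrix.mulVec, dotProduct, hrow A hA]
  -- members of V' = P V Q
  have conj_mem : ∀ (P Q : Matrix (Fin 4) (Fin 4) ℂ) (e : Matrix (Fin 4) (Fin 4) ℂ ≃ₗ[ℂ] Matrix (Fin 4) (Fin 4) ℂ),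
      (∀ X, e X = P * X * Q) → ∀ B' ∈ V.map (e : Matrix (Fin 4) (Fin 4) ℂ →ₗ[ℂ] Matrix (Fin 4) (Fin 4) ℂ),
        ∃ B ∈ V, B' = P * B * Q := by
    intro P Q e he B' hB'
    obtain ⟨B, hB, rfl⟩ := Submodule.mem_map.mp hB'
    exact ⟨B, hB, by simpa using he B⟩
  -- the nilindex split
  by_cases h2 : ∀ A ∈ V, A ^ 2 = 0
  · -- square-zero: the kernel of any non-zero member
    have hne : V ≠ ⊥ := by
      intro h; rw [h, finrank_bot] at hdim; omega
    obtain ⟨A₀, hA₀V, hA₀⟩ := Submodule.exists_mem_ne_zero_of_ne_bot hne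
    obtain ⟨v, hv⟩ : ∃ v : Fin 4 → ℂ, A₀ *ᵥ v ≠ 0 := by
      by_contra h
      push Not at h
      apply hA₀
      ext i j
      have := congr_fun (h (Pi.single j 1)) i
      simpa using this
    refine ⟨LinearMap.ker (Matrix.mulVecLin A₀), ?_, ?_, ?_⟩
    · intro h
      have hmem : A₀ *ᵥ v ∈ LinearMap.ker (Matrix.mulVecLin A₀) := by
        rw [LinearMap.mem_ker, Matrix.mulVecLin_apply, Matrix.mulVec_mulVec, ← pow_two, h2 A₀ hA₀V,
          Matrix.zero_mulVec]
      rw [h] at hmem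
      exact hv ((Submodule.mem_bot ℂ).mp hmem)
    · intro h
      have hmem : v ∈ LinearMap.ker (Matrix.mulVecLin A₀) := by rw [h]; exact Submodule.mem_top
      exact hv (by simpa using hmem)
    · intro A hA u hu
      rw [LinearMap.mem_ker, Matrix.mulVecLin_apply] at hu ⊢
      exact HeavyTopIrreducibleData.reducible_of_sq_zero V (fun X hX => by rw [← pow_two]; exact h2 X hX)
        hA₀V hA u hu
  · push Not at h2
    obtain ⟨A₁, hA₁V, hA₁⟩ := h2
    by_cases h3 : ∀ A ∈ V, A ^ 3 = 0
    · -- generic type (3,1)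
      obtain ⟨P, Q, hPQ, hQP, hPAQ⟩ := hJ31 A₁ (h3 A₁ hA₁V) hA₁
      obtain ⟨e, he⟩ := conjEquiv_exists P Q hPQ hQP
      set V' := V.map (e : Matrix (Fin 4) (Fin 4) ℂ →ₗ[ℂ] Matrix (Fin 4) (Fin 4) ℂ) with hV'def
      have hdim' : 4 ≤ Module.finrank ℂ V' := by
        rw [hV'def, LinearEquiv.finrank_map_eq]; exact hdim
      have hV'3 : ∀ B' ∈ V', B' ^ 3 = 0 := by
        intro B' hB'
        obtain ⟨B, hB, rfl⟩ := conj_mem P Q e he B' hB'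
        rw [conj_pow_eq P Q B hQP 3 (by norm_num), h3 B hB, Matrix.mul_zero, Matrix.zero_mul]
      have hA' : (!![0, 1, 0, 0; 0, 0, 1, 0; 0, 0, 0, 0; 0, 0, 0, 0] : Matrix (Fin 4) (Fin 4) ℂ) ∈ V' := by
        rw [← hPAQ, ← he]; exact Submodule.mem_map_of_mem hA₁V
      have hT : ∀ B ∈ V', B 2 0 = 0 ∧ B 3 0 = 0 ∧ B 2 3 = 0 ∧ B 3 3 = 0 ∧ B 2 1 = -B 1 0 ∧
          B 0 0 + B 1 1 + B 2 2 = 0 := by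
        intro B hB
        obtain ⟨h20, h30, h23, h21, hsum⟩ := constraints_of_E12_E23 V' hV'3 hA' B hB
        have h33 := entry33_eq_zero_of_E12_E23 V' hV'3 hA' B hB
        exact ⟨h20, h30, h23, h33, by linear_combination h21, hsum⟩
      have hcol := typeThreeOne_col V' hV'3 hT hdim'
      refine transport_col P Q hPQ hQP fun B hB i => ?_
      have : P * B * Q ∈ V' := by rw [← he]; exact Submodule.mem_map_of_mem hB
      exact hcol _ this i
    · -- generic type (4)
      push Not at h3
      obtain ⟨A₂, hA₂V, hA₂⟩ := h3
      obtain ⟨P, Q, hPQ, hQP, hPAQ⟩ := hJ4 A₂ (hV4 A₂ hA₂V) hA₂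
      obtain ⟨e, he⟩ := conjEquiv_exists P Q hPQ hQP
      set V' := V.map (e : Matrix (Fin 4) (Fin 4) ℂ →ₗ[ℂ] Matrix (Fin 4) (Fin 4) ℂ) with hV'def
      have hdim' : 4 ≤ Module.finrank ℂ V' := by
        rw [hV'def, LinearEquiv.finrank_map_eq]; exact hdim
      have hV'4 : ∀ B' ∈ V', B' ^ 4 = 0 := by
        intro B' hB'
        obtain ⟨B, hB, rfl⟩ := conj_mem P Q e he B' hB'
        rw [conj_pow_eq P Q B hQP 4 (by norm_num), hV4 B hB, Matrix.mul_zero, Matrix.zero_mul]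
      have hJ' : (!![0, 1, 0, 0; 0, 0, 1, 0; 0, 0, 0, 1; 0, 0, 0, 0] : Matrix (Fin 4) (Fin 4) ℂ) ∈ V' := by
        rw [← hPAQ, ← he]; exact Submodule.mem_map_of_mem hA₂V
      have hT : ∀ B ∈ V', B 3 0 = 0 ∧ B 2 0 + B 3 1 = 0 ∧ B 1 0 + B 2 1 + B 3 2 = 0 := fun B hB =>
        constraints_of_J4 V' hV'4 hJ' B hB
      rcases typeFour_row_or_col V' hV'4 hJ' hT hdim' with hrow | hcol
      · refine transport_row P Q hPQ hQP fun B hB j => ?_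
        have : P * B * Q ∈ V' := by rw [← he]; exact Submodule.mem_map_of_mem hB
        exact hrow _ this j
      · refine transport_col P Q hPQ hQP fun B hB i => ?_
        have : P * B * Q ∈ V' := by rw [← he]; exact Submodule.mem_map_of_mem hB
        exact hcol _ this i

end Summit.ValiantsHypothesis.ValiantsHypothesis.Theorems.GrenetZeon.HeavyTopIotaFour

end
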